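import Summits.QuantumFields.YangMills.Theorems.BalabanUVNodesN15TwoGridDressedDivergenceByParts
import Summits.QuantumFields.YangMills.Theorems.BalabanUVNodesN15FullPropagatorEntry2Rows
import Summits.QuantumFields.YangMills.Theorems.BalabanUVNodesN15BackgroundSiteWords
import HarnessLib

/-!
# N15 (NE2) — PROGRAMME D «THE DRESSED SOURCE-DIVERGENCE ENTRY OF THE PAIR OF RECORD», part D-C: THE DRESSED SOURCE DIVERGENCE ON ONE GRID — ITS BLOCK MAJORANT AND ★ ITS ONE-STEP
# (HÖLDER) LETTER `(τ_ι − 1)∘(X∇*_κ) ≤ H·e^{−ρd}` WITH `H` EXPLICIT IN THE ONE-STEP LETTERS OF THE `U ≡ 1` ROWS «G», «G∇*» — NO MIXED ROW «∇G∇*»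

WHO ∕ WHEN.  Cell `pub-ymgap`, seat `pub-ymgap-dag-n15-a` (KNIT-BY-NAME seat of Track-A DAG node N15 = NE2, g26); `--kind proof --supports stmt-QuantumFields-27366 --as helper` (K3⁸;
count-neutral).  THEOREMS ONLY (0 `def`).  Over D-A `…TwoGridDressedDivergenceByParts` (`bgPairDiv_fix`, `comp_firstOrder_eq_translate`, `mulOp_sub_sum_mulOp`), II-B `…TwoGridFirstOrderLetters`
(`hasMaj_bgPair_comp`, `hasMaj_byPartsStep`, `hasMaj_mulOp_comp`), n15-c W `…FullPropagatorEntry2Rows` (`symbOp_sT_eq_pull`, `symbOp_sT_sub_one_eq`, `hasMaj_fshift_comp`), n15-b SiteWords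
(`hasMaj_exp_mono`), `B11SectG` (`neumann_majorant`, `hasMaj_comp_exp`), part 3 `hasMaj_finsum`, `DerivDefect.exists_const_hasMaj_ofBlocks` BY NAME; nothing in the tree is modified.

WHY.  D-B's ★★★ `hasMaj_idef_dressedDiv_of_letters` consumes three letters about the COARSE dressed source divergence `Y = X∘∇*_κ` (`X = (1 − GV₁)⁻¹G`, first-order species): its block majorant
`β_Y`, and its ONE-STEP letters `(τ_ι − 1)∘Y ≤ H_Y e^{−ρd}` — the currency in which the two new two-grid terms of the by-parts route are paid (the defect of the fine against the coarse unit shift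
through King's prolongation, n15-c `hasMaj_idefFShift_comp`, and the junk of the by-parts remainders, D-D).  THIS FILE derives both on ONE torus from `U ≡ 1` rows: `β_Y` by the Neumann series of
`Y = G∇*_κ + (GV₁)Y` (D-A `bgPairDiv_fix`, step majorant II-B `hasMaj_byPartsStep`); `H_Y` EXPLICITLY — no second Neumann series — from the same equation read one step apart with the step in
TRANSLATION FORM (D-A): `(τ_ι − 1)Y = (τ_ι − 1)(G∇*_κ) + [(τ_ι − 1)G](M_c − Σ_μM_{b_μ})Y − Σ_μ [(τ_ι − 1)(G∇*_μ)]M_{a_μ}τ_μY`, so `H_Y = h_S + n⁻¹β·R_w β_Y c_r + (d+1)·h_S·r β_Y e^{ρ} c_r` with `h_S`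
the one-step letter of «G∇*» ([B5] (1.111), dag-n15-a part 66 ∕ n15-c `hasMaj_oneStepFwd_gDivAdj`: `h_S = C(L^k)^{−α}`) and `n⁻¹β` that of «G» ((1.110)'s «∇G» read as a one-step difference).
The MIXED row «∇G∇*» never appears: the derivative of the species was moved onto the `U ≡ 1` factors by D-A.

WHAT ([folklore] bookkeeping; 0 def).  One torus `Tor (fine n M)`, unit blocks, geometry `unitTorusGeo L k M`; `E_μ := ρ(n(s_μ⁻¹ − 1))`, `τ_μ := ρ(s_μ)`, `Y := pr₀(bgPair G (∇∘G) c a)∘E_κ`.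
* §21 `comp_dressed_translate` (abstract: `T∘Y` expanded along `Y = S + (G(M_c − ΣM_b) − ΣS_μM_{a_μ}τ_μ)Y`), `pull_bshift_sub_id_comp_eq` (`(τ_ι − 1)∘G = n⁻¹·(∇_ιG)`).
* §22 ★ `hasMaj_dressedDiv` (`Y ≤ C₁(1 − q′)⁻¹e^{−ρd}`, `q′ = (βr + (d+1)(C₂r + βr_b))c_r`), ★★ `hasMaj_fstep_dressedDiv` (`(τ_ι − 1)∘Y ≤ (h_S + n⁻¹β R_w β_Y c_r + (d+1)h_S r β_Y e^{ρ} c_r)e^{−ρd}` from the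
  one-step letters `h_S` of `G∇*_μ` (all `μ`), the rows, the coefficient letters `|c|, |a_μ| ≤ r`, `|∇⁻_μa_μ| ≤ r_b`, and a majorant `β_Y` of `Y`).

HONEST FRAMING ∕ LIMITS.  Block-majorant bookkeeping over hypothesis-shaped `U ≡ 1` rows on the torus MODEL of [B5] §1 (D-E instantiates at Bałaban's `Δ_a⁻¹` hypothesis-free); abelianised
scalar-multiplier species (MODEL of [B9] (3.52)'s `V′(A)`); nothing of [B5]∕[B6]∕[B9] asserted; NE2⁺ NOT PRINTED ∕ NOT proved; no statement of record touched; N15 NOT discharged; K3⁸ OPEN; counts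
UNMOVED (typed 28∕28 · discharged 5∕27); one finite torus — NOT infinite volume ∕ ℝ⁴ ∕ OS ∕ mass gap ∕ Clay.
-/

noncomputable section

open scoped BigOperators
open Finset

namespace Summit.QuantumFields.YangMills.BalabanUVNodes.N15.TwoGrid

open Literature.MathematicalPhysics.QuantumFieldTheory.Balaban1983to89
open Literature.MathematicalPhysics.QuantumFieldTheory.Balaban1983to89.B11SectG (BlockNorm HasMaj hasMaj_comp hasMaj_comp_exp RowSum neumann_majorant)
open Literature.MathematicalPhysics.QuantumFieldTheory.Balaban1983to89.T4EtaRateCoeffDefect (pull pull_apply)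
open Literature.MathematicalPhysics.QuantumFieldTheory.Balaban1983to89.B6RandomWalk (Triangle254)
open Literature.MathematicalPhysics.QuantumFieldTheory.Balaban1983to89.B6Prop26Gluing (mulOp mulOp_apply)
open Literature.MathematicalPhysics.QuantumFieldTheory.Balaban1983to89.B5Prop11Plancherel (Tor fine unitVec)
open Literature.MathematicalPhysics.QuantumFieldTheory.King1986.Torus (blockOf tdistT tdistT_nonneg)
open Literature.MathematicalPhysics.QuantumFieldTheory.Balaban1983to89.B6UnitTorusCarrier (unitTorusGeo triangle254_unitTorusGeo)
open Summit.QuantumFields.YangMills.BalabanUVNodes.N15.VectorPiece (bshiftEquiv)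
open Summit.QuantumFields.YangMills.BalabanUVNodes.N15.BackgroundModel (kappa_ofBlocks)
open Summit.QuantumFields.YangMills.BalabanUVNodes.N15.DerivDefect (exists_const_hasMaj_ofBlocks)
open Summit.QuantumFields.YangMills.BalabanUVNodes.N15.BackgroundLayer (bgPair projO hasMaj_fshift_comp symbOp_sT_sub_one_eq)
open Summit.QuantumFields.YangMills.BalabanUVNodes.N15.SiteLayer (hasMaj_exp_mono)

variable {d : ℕ}

/-! ## §21 Two pieces of algebra -/

section Algebra

/-- **A LEFT FACTOR THROUGH THE TRANSLATION-FORM FIXED POINT**: if `Y = S + (G∘W − Σ_μ S_μ∘(M_μ∘τ_μ))∘Y` then, for every linear `T`,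
`T∘Y = T∘S + (T∘G)∘(W∘Y) − Σ_μ (T∘S_μ)∘(M_μ∘(τ_μ∘Y))` — the left factor lands on the `U ≡ 1` pieces only. [folklore] -/
theorem comp_dressed_translate {ι F₀ F₁ F₂ : Type} [Fintype ι] [AddCommGroup F₀] [Module ℝ F₀] [AddCommGroup F₁] [Module ℝ F₁] [AddCommGroup F₂] [Module ℝ F₂]
    {Y S : F₀ →ₗ[ℝ] F₁} {G W : F₁ →ₗ[ℝ] F₁} {Sμ Mμ τ : ι → F₁ →ₗ[ℝ] F₁} (hfix : Y = S + (G ∘ₗ W - ∑ μ, Sμ μ ∘ₗ (Mμ μ ∘ₗ τ μ)) ∘ₗ Y) (T : F₁ →ₗ[ℝ] F₂) :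
    T ∘ₗ Y = T ∘ₗ S + (T ∘ₗ G) ∘ₗ (W ∘ₗ Y) - ∑ μ, (T ∘ₗ Sμ μ) ∘ₗ (Mμ μ ∘ₗ (τ μ ∘ₗ Y)) := by
  refine LinearMap.ext fun v => ?_
  have h := LinearMap.congr_fun hfix v
  rw [LinearMap.comp_apply, h]
  simp only [LinearMap.comp_apply, LinearMap.add_apply, LinearMap.sub_apply, LinearMap.sum_apply, map_add, map_sub, map_sum]
  abel

variable (M : Fin (d + 1) → ℕ) [∀ μ, NeZero (M μ)] (n : ℕ) [NeZero n]

omit [∀ μ, NeZero (M μ)] in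
/-- `(τ_ι − 1)∘T = n⁻¹·(ρ(sD_ι n)∘T)`: a one-step difference is `η` times the difference quotient. [cite: Balaban1984PropagatorsI, (1.3) p.18 (lattice derivative: shape)] -/
theorem pull_bshift_sub_id_comp_eq {F₀ : Type} [AddCommGroup F₀] [Module ℝ F₀] (ι : Fin (d + 1)) (T : F₀ →ₗ[ℝ] (Tor (fine n M) × Fin (d + 1) → ℝ)) :
    (pull ⇑(bshiftEquiv M n ι) - LinearMap.id) ∘ₗ T = (n : ℝ)⁻¹ • (symbOp M n (sD M n ι (n : ℝ)) ∘ₗ T) := by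
  have hn : (n : ℝ) ≠ 0 := Nat.cast_ne_zero.mpr (NeZero.ne n)
  rw [← symbOp_sT_sub_one_eq, sD, map_smul, LinearMap.smul_comp, smul_smul, inv_mul_cancel₀ hn, one_smul]

end Algebra

/-! ## §22 The dressed source divergence on one grid: majorant and one-step letter -/

section OneGrid

variable {L : ℕ} (M : Fin (d + 1) → ℕ) [∀ μ, NeZero (M μ)] (k n : ℕ) [NeZero n]

/-- ★ **THE BLOCK MAJORANT OF THE DRESSED SOURCE DIVERGENCE `Y = X∘∇*_κ`** on one torus, from `U ≡ 1` rows and (3.35) letters: `Y ≤ C₁(1 − q′)⁻¹·e^{−ρd}`, `q′ = (βr + (d+1)(C₂r + βr_b))c_r` —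
the Neumann series of `Y = G∇*_κ + (GV₁)Y` (D-A `bgPairDiv_fix`) with the step majorant of II-B `hasMaj_byPartsStep` (no derivative on `Y`). [cite: Balaban1985BackgroundPropagators, Thm 3.1 (3.42)
p.397 (entry `G(U)∇*`: shape), (3.62)–(3.65) pp.402–403 (mechanism), (3.35) p.396 (letters); Balaban1984PropagatorsI, Prop. 1.2 (1.110) p.35 (rows «G», «∇G», «G∇*»)] -/
theorem hasMaj_dressedDiv {σ cr : ℝ} (hσ : 0 ≤ σ) (hrow : RowSum (unitTorusGeo L k M) σ cr) {ρ δ β C₁ C₂ r rb : ℝ} (hρ : 0 ≤ ρ) (hρδ : ρ + σ ≤ δ) (hβ : 0 ≤ β) (hC₁ : 0 ≤ C₁)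
    (hC₂ : 0 ≤ C₂) (hr : 0 ≤ r) (hrb : 0 ≤ rb) (κ : Fin (d + 1))
    {G : (Tor (fine n M) × Fin (d + 1) → ℝ) →ₗ[ℝ] (Tor (fine n M) × Fin (d + 1) → ℝ)} {c : Tor (fine n M) × Fin (d + 1) → ℝ} {a : Fin (d + 1) → Tor (fine n M) × Fin (d + 1) → ℝ}
    (hG : HasMaj (BlockNorm.ofBlocks (unitTorusGeo L k M) (fun i : Tor (fine n M) × Fin (d + 1) => blockOf n M i.1))
      (BlockNorm.ofBlocks (unitTorusGeo L k M) (fun i : Tor (fine n M) × Fin (d + 1) => blockOf n M i.1)) G (fun y y' => β * Real.exp (-(δ * tdistT M y y'))))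
    (hGD : ∀ μ, HasMaj (BlockNorm.ofBlocks (unitTorusGeo L k M) (fun i : Tor (fine n M) × Fin (d + 1) => blockOf n M i.1))
      (BlockNorm.ofBlocks (unitTorusGeo L k M) (fun i : Tor (fine n M) × Fin (d + 1) => blockOf n M i.1)) (symbOp M n (sD M n μ (n : ℝ)) ∘ₗ G)
      (fun y y' => β * Real.exp (-(δ * tdistT M y y'))))
    (hGgrad : ∀ μ, HasMaj (BlockNorm.ofBlocks (unitTorusGeo L k M) (fun i : Tor (fine n M) × Fin (d + 1) => blockOf n M i.1))
      (BlockNorm.ofBlocks (unitTorusGeo L k M) (fun i : Tor (fine n M) × Fin (d + 1) => blockOf n M i.1)) (G ∘ₗ symbOp M n (sD M n μ (n : ℝ)))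
      (fun y y' => C₂ * Real.exp (-(δ * tdistT M y y'))))
    (hGdiv : HasMaj (BlockNorm.ofBlocks (unitTorusGeo L k M) (fun i : Tor (fine n M) × Fin (d + 1) => blockOf n M i.1))
      (BlockNorm.ofBlocks (unitTorusGeo L k M) (fun i : Tor (fine n M) × Fin (d + 1) => blockOf n M i.1)) (G ∘ₗ symbOp M n ((n : ℝ) • (sTinv M n κ - 1)))
      (fun y y' => C₁ * Real.exp (-(δ * tdistT M y y'))))
    (hc : ∀ z, |c z| ≤ r) (ha : ∀ μ z, |a μ z| ≤ r) (hb : ∀ μ z, |(n : ℝ) * (a μ z - a μ (z.1 - unitVec (fine n M) μ, z.2))| ≤ rb)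
    (hq : β * (r * (d + 2)) * cr < 1) (hqK : (β * r + (d + 1) * (C₂ * r + β * rb)) * cr < 1) :
    HasMaj (BlockNorm.ofBlocks (unitTorusGeo L k M) (fun i : Tor (fine n M) × Fin (d + 1) => blockOf n M i.1))
      (BlockNorm.ofBlocks (unitTorusGeo L k M) (fun i : Tor (fine n M) × Fin (d + 1) => blockOf n M i.1))
      ((projO none ∘ₗ bgPair G (fun μ => symbOp M n (sD M n μ (n : ℝ)) ∘ₗ G) c a) ∘ₗ symbOp M n ((n : ℝ) • (sTinv M n κ - 1)))
      (fun y y' => C₁ * (1 - (β * r + (d + 1) * (C₂ * r + β * rb)) * cr)⁻¹ * Real.exp (-(ρ * tdistT M y y'))) := by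
  have htri : Triangle254 (unitTorusGeo L k M) := triangle254_unitTorusGeo L k M
  have hd : ∀ a b : (unitTorusGeo L k M).Site, 0 ≤ (unitTorusGeo L k M).dist a b := fun a b => tdistT_nonneg M a b
  have hρδ' : ρ ≤ δ := by linarith
  have hR : r * (1 + (Fintype.card (Fin (d + 1)) : ℝ)) ≤ r * (d + 2) := by rw [Fintype.card_fin]; push_cast; exact le_of_eq (by ring)
  set b := BlockNorm.ofBlocks (unitTorusGeo L k M) (fun i : Tor (fine n M) × Fin (d + 1) => blockOf n M i.1) with hb_def
  set Dc : Fin (d + 1) → (Tor (fine n M) × Fin (d + 1) → ℝ) →ₗ[ℝ] (Tor (fine n M) × Fin (d + 1) → ℝ) := fun μ => symbOp M n (sD M n μ (n : ℝ)) with hDc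
  set E := symbOp M n ((n : ℝ) • (sTinv M n κ - 1)) with hE_def
  set Yv := (projO none ∘ₗ bgPair G (fun μ => Dc μ ∘ₗ G) c a) ∘ₗ E with hYv_def
  set K := G ∘ₗ (mulOp c + ∑ μ, mulOp (a μ) ∘ₗ Dc μ) with hK_def
  -- unit, fixed point, step, source, a priori bound, Neumann
  have hunit := (hasMaj_bgPair_comp (g := unitTorusGeo L k M) (fun i : Tor (fine n M) × Fin (d + 1) => blockOf n M i.1) (Dc := Dc) htri hd hrow hσ hρ hρδ hβ hr hG hGD hc
    ha hR hq none).1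
  have hfix : Yv = G ∘ₗ E + K ∘ₗ Yv := bgPairDiv_fix hunit E
  have hK : HasMaj b b K (fun y y' => (β * r + (d + 1) * (C₂ * r + β * rb)) * Real.exp (-(δ * tdistT M y y'))) :=
    hasMaj_byPartsStep M k n hβ hC₂ hr hr hrb hG hGgrad hc ha hb
  have hS : HasMaj b b (G ∘ₗ E) (fun y y' => C₁ * Real.exp (-(ρ * (unitTorusGeo L k M).dist y y'))) := hasMaj_exp_mono (g := unitTorusGeo L k M) hd hC₁ hρδ' hGdiv
  obtain ⟨M₀, hM₀, hap⟩ := exists_const_hasMaj_ofBlocks (g := unitTorusGeo L k M) (fun i : Tor (fine n M) × Fin (d + 1) => blockOf n M i.1)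
    (fun i : Tor (fine n M) × Fin (d + 1) => blockOf n M i.1) Yv
  have hθ : 0 ≤ β * r + (d + 1) * (C₂ * r + β * rb) := by positivity
  have hq1 : b.κ * (β * r + (d + 1) * (C₂ * r + β * rb)) * cr < 1 := by rw [hb_def, kappa_ofBlocks, one_mul]; exact hqK
  have key := neumann_majorant htri hd hrow hθ hC₁ hM₀ hρ hρδ hK hS hfix hap hq1
  refine key.mono fun y y' => le_of_eq ?_
  rw [hb_def, kappa_ofBlocks, one_mul]

/-- ★★ **THE ONE-STEP (HÖLDER) LETTER OF THE DRESSED SOURCE DIVERGENCE, EXPLICIT**: on one torus, from the one-step letters `(τ_ι − 1)∘(G∇*_μ) ≤ h_S e^{−δd}` of the `U ≡ 1` entry «G∇*» (ALL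
`μ`), the rows «∇G» `≤ βe^{−δd}` and «G∇*» , the (3.35) letters `|c|, |a_μ| ≤ r`, `|∇⁻_μa_μ| ≤ r_b`, and a block majorant `Y ≤ β_Y e^{−ρd}` of the dressed source divergence `Y = X∘∇*_κ`:
`(τ_ι − 1)∘Y ≤ (h_S + n⁻¹β·R_w β_Y c_r + (d+1)·h_S·r·β_Y e^{ρ}·c_r)·e^{−ρ′d}` for `ρ′ + σ ≤ ρ ≤ δ − σ`, `R_w = r + (d+1)r_b` — the translation-form equation read one step apart; NO mixed row
«∇G∇*», NO second Neumann series. [cite: Balaban1984PropagatorsI, Prop. 1.2 (1.110)–(1.111) p.35 (rows and Hölder letters of «G∇*», «∇G»: shapes); Balaban1985BackgroundPropagators, (3.35) p.396,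
(3.52) p.400, (3.62)–(3.65) pp.402–403 (mechanism)] -/
theorem hasMaj_fstep_dressedDiv {σ cr : ℝ} (hσ : 0 ≤ σ) (hrow : RowSum (unitTorusGeo L k M) σ cr) {ρ ρ' δ β hS r rb βY : ℝ} (hρ' : 0 ≤ ρ') (hρ'ρ : ρ' + σ ≤ ρ) (hρδ : ρ + σ ≤ δ)
    (hβ : 0 ≤ β) (hhS : 0 ≤ hS) (hr : 0 ≤ r) (hrb : 0 ≤ rb) (hβY : 0 ≤ βY) (κ ι : Fin (d + 1))
    {G : (Tor (fine n M) × Fin (d + 1) → ℝ) →ₗ[ℝ] (Tor (fine n M) × Fin (d + 1) → ℝ)} {c : Tor (fine n M) × Fin (d + 1) → ℝ} {a : Fin (d + 1) → Tor (fine n M) × Fin (d + 1) → ℝ}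
    (hG : HasMaj (BlockNorm.ofBlocks (unitTorusGeo L k M) (fun i : Tor (fine n M) × Fin (d + 1) => blockOf n M i.1))
      (BlockNorm.ofBlocks (unitTorusGeo L k M) (fun i : Tor (fine n M) × Fin (d + 1) => blockOf n M i.1)) G (fun y y' => β * Real.exp (-(δ * tdistT M y y'))))
    (hGD : ∀ μ, HasMaj (BlockNorm.ofBlocks (unitTorusGeo L k M) (fun i : Tor (fine n M) × Fin (d + 1) => blockOf n M i.1))
      (BlockNorm.ofBlocks (unitTorusGeo L k M) (fun i : Tor (fine n M) × Fin (d + 1) => blockOf n M i.1)) (symbOp M n (sD M n μ (n : ℝ)) ∘ₗ G)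
      (fun y y' => β * Real.exp (-(δ * tdistT M y y'))))
    (hSstep : ∀ μ, HasMaj (BlockNorm.ofBlocks (unitTorusGeo L k M) (fun i : Tor (fine n M) × Fin (d + 1) => blockOf n M i.1))
      (BlockNorm.ofBlocks (unitTorusGeo L k M) (fun i : Tor (fine n M) × Fin (d + 1) => blockOf n M i.1))
      ((pull ⇑(bshiftEquiv M n ι) - LinearMap.id) ∘ₗ (G ∘ₗ symbOp M n ((n : ℝ) • (sTinv M n μ - 1)))) (fun y y' => hS * Real.exp (-(δ * tdistT M y y'))))
    (hc : ∀ z, |c z| ≤ r) (ha : ∀ μ z, |a μ z| ≤ r) (hb : ∀ μ z, |(n : ℝ) * (a μ z - a μ (z.1 - unitVec (fine n M) μ, z.2))| ≤ rb) (hq : β * (r * (d + 2)) * cr < 1)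
    (hY : HasMaj (BlockNorm.ofBlocks (unitTorusGeo L k M) (fun i : Tor (fine n M) × Fin (d + 1) => blockOf n M i.1))
      (BlockNorm.ofBlocks (unitTorusGeo L k M) (fun i : Tor (fine n M) × Fin (d + 1) => blockOf n M i.1))
      ((projO none ∘ₗ bgPair G (fun μ => symbOp M n (sD M n μ (n : ℝ)) ∘ₗ G) c a) ∘ₗ symbOp M n ((n : ℝ) • (sTinv M n κ - 1)))
      (fun y y' => βY * Real.exp (-(ρ * tdistT M y y')))) :
    HasMaj (BlockNorm.ofBlocks (unitTorusGeo L k M) (fun i : Tor (fine n M) × Fin (d + 1) => blockOf n M i.1))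
      (BlockNorm.ofBlocks (unitTorusGeo L k M) (fun i : Tor (fine n M) × Fin (d + 1) => blockOf n M i.1))
      ((pull ⇑(bshiftEquiv M n ι) - LinearMap.id) ∘ₗ
        ((projO none ∘ₗ bgPair G (fun μ => symbOp M n (sD M n μ (n : ℝ)) ∘ₗ G) c a) ∘ₗ symbOp M n ((n : ℝ) • (sTinv M n κ - 1))))
      (fun y y' => (hS + (n : ℝ)⁻¹ * β * ((r + (d + 1) * rb) * βY) * cr + (d + 1) * (hS * (r * (βY * Real.exp ρ)) * cr)) * Real.exp (-(ρ' * tdistT M y y'))) := by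
  have htri : Triangle254 (unitTorusGeo L k M) := triangle254_unitTorusGeo L k M
  have hd : ∀ a b : (unitTorusGeo L k M).Site, 0 ≤ (unitTorusGeo L k M).dist a b := fun a b => tdistT_nonneg M a b
  have hρ : 0 ≤ ρ := by linarith
  have hρ'δ : ρ' ≤ δ := by linarith
  have hρ'δσ : ρ' + σ ≤ δ := by linarith
  have hn0 : (0 : ℝ) < (n : ℝ) := Nat.cast_pos.mpr (Nat.pos_of_ne_zero (NeZero.ne n))
  have hninv : 0 ≤ (n : ℝ)⁻¹ := inv_nonneg.mpr hn0.le
  have hR : r * (1 + (Fintype.card (Fin (d + 1)) : ℝ)) ≤ r * (d + 2) := by rw [Fintype.card_fin]; push_cast; exact le_of_eq (by ring)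
  have hRw : 0 ≤ r + (d + 1) * rb := by positivity
  set b := BlockNorm.ofBlocks (unitTorusGeo L k M) (fun i : Tor (fine n M) × Fin (d + 1) => blockOf n M i.1) with hb_def
  set Dc : Fin (d + 1) → (Tor (fine n M) × Fin (d + 1) → ℝ) →ₗ[ℝ] (Tor (fine n M) × Fin (d + 1) → ℝ) := fun μ => symbOp M n (sD M n μ (n : ℝ)) with hDc
  set Ec : Fin (d + 1) → (Tor (fine n M) × Fin (d + 1) → ℝ) →ₗ[ℝ] (Tor (fine n M) × Fin (d + 1) → ℝ) := fun μ => symbOp M n ((n : ℝ) • (sTinv M n μ - 1)) with hEc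
  set τc : Fin (d + 1) → (Tor (fine n M) × Fin (d + 1) → ℝ) →ₗ[ℝ] (Tor (fine n M) × Fin (d + 1) → ℝ) := fun μ => symbOp M n (sT M n μ) with hτc
  set bq : Fin (d + 1) → Tor (fine n M) × Fin (d + 1) → ℝ := fun μ z => (n : ℝ) * (a μ z - a μ (z.1 - unitVec (fine n M) μ, z.2)) with hbq_def
  set Yv := (projO none ∘ₗ bgPair G (fun μ => Dc μ ∘ₗ G) c a) ∘ₗ Ec κ with hYv_def
  set K := G ∘ₗ (mulOp c + ∑ μ, mulOp (a μ) ∘ₗ Dc μ) with hK_def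
  set T := (pull ⇑(bshiftEquiv M n ι) - LinearMap.id : (Tor (fine n M) × Fin (d + 1) → ℝ) →ₗ[ℝ] (Tor (fine n M) × Fin (d + 1) → ℝ)) with hT_def
  -- the fixed point with the step in translation form (D-A)
  have hunit := (hasMaj_bgPair_comp (g := unitTorusGeo L k M) (fun i : Tor (fine n M) × Fin (d + 1) => blockOf n M i.1) (Dc := Dc) htri hd hrow hσ hρ hρδ hβ hr hG hGD hc
    ha hR hq none).1
  have hfix0 : Yv = G ∘ₗ Ec κ + K ∘ₗ Yv := bgPairDiv_fix hunit (Ec κ)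
  have hKt : K = G ∘ₗ (mulOp c - ∑ μ, mulOp (bq μ)) - ∑ μ, (G ∘ₗ Ec μ) ∘ₗ (mulOp (a μ) ∘ₗ τc μ) := comp_firstOrder_eq_translate M n G (n : ℝ) c a
  have hfix : Yv = G ∘ₗ Ec κ + (G ∘ₗ (mulOp c - ∑ μ, mulOp (bq μ)) - ∑ μ, (G ∘ₗ Ec μ) ∘ₗ (mulOp (a μ) ∘ₗ τc μ)) ∘ₗ Yv := by rw [← hKt]; exact hfix0
  have hexp := comp_dressed_translate hfix T
  -- the multiplier letters
  have hwc : ∀ z, |(fun z => c z - ∑ μ, bq μ z) z| ≤ r + (d + 1) * rb := by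
    intro z
    have h1 : |∑ μ, bq μ z| ≤ ∑ _μ : Fin (d + 1), rb := (Finset.abs_sum_le_sum_abs _ _).trans (Finset.sum_le_sum fun μ _ => hb μ z)
    rw [sum_const, card_univ, Fintype.card_fin, nsmul_eq_mul] at h1
    calc |c z - ∑ μ, bq μ z| ≤ |c z| + |∑ μ, bq μ z| := abs_sub _ _
      _ ≤ r + (d + 1) * rb := add_le_add (hc z) (by push_cast at h1 ⊢; linarith)
  -- term 0: the one-step letter of the source
  have h0 : HasMaj b b (T ∘ₗ (G ∘ₗ Ec κ)) (fun y y' => hS * Real.exp (-(ρ' * (unitTorusGeo L k M).dist y y'))) := hasMaj_exp_mono (g := unitTorusGeo L k M) hd hhS hρ'δ (hSstep κ)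
  -- term 1: `[(τ−1)G]∘(M_c − ΣM_b)∘Y` with `(τ−1)G = n⁻¹∇G`
  have hTG : HasMaj b b (T ∘ₗ G) (fun y y' => (n : ℝ)⁻¹ * β * Real.exp (-(δ * (unitTorusGeo L k M).dist y y'))) := by
    rw [hT_def, pull_bshift_sub_id_comp_eq M n ι G]
    refine (TwoGrid.hasMaj_smul_ofBlocks (g := unitTorusGeo L k M) (fun i : Tor (fine n M) × Fin (d + 1) => blockOf n M i.1) (fun _ _ => mul_nonneg hβ (Real.exp_nonneg _))
      ((n : ℝ)⁻¹) (hGD ι)).mono fun y y' => le_of_eq ?_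
    rw [abs_of_nonneg hninv]
    ring
  have hW : HasMaj b b ((mulOp c - ∑ μ, mulOp (bq μ)) ∘ₗ Yv) (fun y y' => ((r + (d + 1) * rb) * βY) * Real.exp (-(ρ * (unitTorusGeo L k M).dist y y'))) := by
    rw [mulOp_sub_sum_mulOp]
    exact (hasMaj_mulOp_comp (g := unitTorusGeo L k M) (fun i : Tor (fine n M) × Fin (d + 1) => blockOf n M i.1) (fun _ _ => mul_nonneg hβY (Real.exp_nonneg _)) hRw hwc hY).mono
      fun y y' => le_of_eq (by ring)
  have h1 : HasMaj b b ((T ∘ₗ G) ∘ₗ ((mulOp c - ∑ μ, mulOp (bq μ)) ∘ₗ Yv))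
      (fun y y' => b.κ * ((n : ℝ)⁻¹ * β) * ((r + (d + 1) * rb) * βY) * cr * Real.exp (-(ρ' * (unitTorusGeo L k M).dist y y'))) :=
    hasMaj_comp_exp (b₁ := b) (b₂ := b) (b₃ := b) htri hd hrow (mul_nonneg hninv hβ) (mul_nonneg hRw hβY) hρ' (by linarith) hρ'δσ hTG hW
  -- terms 2_μ: `[(τ−1)S_μ]∘M_{a_μ}∘τ_μ∘Y`
  have hβYρ : 0 ≤ βY * Real.exp ρ := by positivity
  have h2 : ∀ μ, HasMaj b b ((T ∘ₗ (G ∘ₗ Ec μ)) ∘ₗ (mulOp (a μ) ∘ₗ (τc μ ∘ₗ Yv)))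
      (fun y y' => b.κ * hS * (r * (βY * Real.exp ρ)) * cr * Real.exp (-(ρ' * (unitTorusGeo L k M).dist y y'))) := by
    intro μ
    have hτY : HasMaj b b (τc μ ∘ₗ Yv) (fun y y' => βY * Real.exp ρ * Real.exp (-(ρ * tdistT M y y'))) := by
      have h := hasMaj_fshift_comp M k n (b₁ := b) hβY hρ μ hY
      rw [← BackgroundLayer.symbOp_sT_eq_pull] at h
      exact h
    have hA : HasMaj b b (mulOp (a μ) ∘ₗ (τc μ ∘ₗ Yv)) (fun y y' => (r * (βY * Real.exp ρ)) * Real.exp (-(ρ * (unitTorusGeo L k M).dist y y'))) :=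
      (hasMaj_mulOp_comp (g := unitTorusGeo L k M) (fun i : Tor (fine n M) × Fin (d + 1) => blockOf n M i.1) (fun _ _ => mul_nonneg hβYρ (Real.exp_nonneg _)) hr (ha μ)
        hτY).mono fun y y' => le_of_eq (by ring)
    exact hasMaj_comp_exp (b₁ := b) (b₂ := b) (b₃ := b) htri hd hrow hhS (mul_nonneg hr hβYρ) hρ' (by linarith) hρ'δσ (hSstep μ) hA
  have h2s := hasMaj_finsum (b₁ := b) (b₂ := b) Finset.univ (fun μ => (T ∘ₗ (G ∘ₗ Ec μ)) ∘ₗ (mulOp (a μ) ∘ₗ (τc μ ∘ₗ Yv)))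
    (fun _ y y' => b.κ * hS * (r * (βY * Real.exp ρ)) * cr * Real.exp (-(ρ' * (unitTorusGeo L k M).dist y y'))) fun μ _ => h2 μ
  rw [hexp]
  refine ((h0.add h1).sub h2s).mono fun y y' => le_of_eq ?_
  rw [sum_const, card_univ, Fintype.card_fin, nsmul_eq_mul, hb_def, kappa_ofBlocks]
  push_cast
  simp only [one_mul]
  ring

end OneGrid

end Summit.QuantumFields.YangMills.BalabanUVNodes.N15.TwoGrid

end
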